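import Mathlib
import Literature.Analysis.FluidPDE.Tao2016AveragedNS.RenormalisedCascadeWaves
import Literature.Analysis.FluidPDE.Tao2016AveragedNS.SelfSimilarCascadeBlowup
import Literature.Analysis.FluidPDE.Tao2016AveragedNS.ViscousEternalSolutions
import Literature.Analysis.FluidPDE.Tao2016AveragedNS.BoundedEternalSolutions
import Summits.NavierStokesRegularity.NavierStokesRegularity.Theses.TaoLadderRungTwoBreak
import Summits.NavierStokesRegularity.NavierStokesRegularity.Theorems.WakeRatchetAdmissibleEternalBoundTerminal

/-!
# Crux `TaoLadderRungTwoBreak.NoSurvivingEternalViscBddOne` (stmt-NavierStokesRegularity-20419):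
# the WAKE CRITERION — forward (S_a)-survival is decided on the terminal (wake) profile

MODEL lattice ODEs only (Tao 2016 §4, log-time variables §6.4); nothing in this file is a statement
about the Navier–Stokes equations, and no stub, crux, rung or summit is proved by it.

Every admissible eternal solution `W` (`IsEternalVisc ε₀ ν̂ α W`, any `ν̂ ≥ 0`, ANY table, no bound
needed) has a TERMINAL PROFILE `r_n = lim_{σ→∞} e^{σ} W_n(σ)` on every shell (tree:
`WakeRatchetTerminal.exists_terminalProfile`); in physical variables `r_n = Λ^n X_n(t⋆)` is the state
STRANDED at shell `n` at the blow-up time — the wake — and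
`physWeight(a)^n ‖r_n‖² = (1+ε₀)^{an} E_n(t⋆)` (`physWeight_pow_mul_eq`: at `a = 1` the
a=1-weighted wake energy `(1+ε₀)^n E_n(t⋆)`).  This file records:

* `tendsto_renEnergy_of_terminal` — `e^{2σ}‖W_n(σ)‖² → ‖r_n‖²`;
* `survivingFwd_of_wakeFloor` — **a wake floor IS survival**: if `physWeight(a)^n ‖r_n‖² > c > 0` for
  infinitely many shells `n ≥ 0`, then `EternalSurvivingFwd a ε₀ W` (the late log-times come for free
  from the limit);
* `weightedWake_tendsto_zero_of_not_survivingFwd` — contrapositive: a non-surviving admissible eternal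
  solution has `physWeight(a)^n ‖r_n‖² → 0` along `n → ∞`;
* BY NAME: `weightedWake_tendsto_zero_of_noSurvivingEternalViscBddOne` /
  `…_of_noSurvivingEternalBddOne` — the crux K1ᵛ(1) (resp. its inviscid child (ρ0)) FORCES, below its
  threshold, `(1+ε₀)^n E_n(t⋆) → 0` for every uniformly bounded admissible (viscous resp. inviscid)
  eternal solution of every E₂(R) table: the wake spectrum must be STRICTLY STEEPER than the a=1
  survival weight; and the KILL TEST `not_noSurvivingEternalViscBddOne_of_wakeWitnesses`: one bounded
  admissible eternal solution per small `ε₀` on E₂(R) tables whose weighted wake does not tend to zero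
  refutes the crux.  This is the quantity the attached numerics measure (wake exponent `a_w(table, ε₀)`:
  `E_n(t⋆) ≈ (1+ε₀)^{-a_w n}`; survival iff `a_w ≤ 1`; computed `a_w → 5/3` on fixed tables).

HONEST LABEL: a reading lemma (limit bookkeeping over the tree's terminal profile); the converse
«survival ⇒ wake floor» is NOT claimed (a survivor may realise its level on the moving front); crux
⟨20419⟩, its children and every NS statement remain OPEN.
-/

noncomputable section

-- the summit and its single sub-problem share the name (CONVENTIONS §1)
set_option linter.dupNamespace false

namespace Summit.NavierStokesRegularity.NavierStokesRegularity.Theorems.NoSurvivingEternalViscBddOne.WakeCriterion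

open Filter Topology Set
open Literature.Analysis.FluidPDE Literature.Analysis.FluidPDE.TaoCascade
open Summit.NavierStokesRegularity.NavierStokesRegularity.Theses.TaoLadderRungTwoBreak

variable {m : ℕ} {ε₀ νh a : ℝ} {α : Fin m → Fin m → Fin m → ℤ × ℤ × ℤ → ℝ} {W : ℤ → ℝ → Em m}

/-! ## The terminal profile and the terminal shell energy -/

/-- **Terminal profile, packaged as a function of the shell.**  Every admissible eternal solution with
covariant viscosity (`ν̂ ≥ 0` arbitrary, any table) has `r : ℤ → ℝ^m` with `e^{σ} W_n(σ) → r_n` for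
every shell.
[cite: Tao2016AveragedNS, §4 Lemma 4.1 (4.8), the viscous equation before Thm. 4.2, §6.4; tree `WakeRatchetTerminal.exists_terminalProfile`] -/
theorem exists_terminalProfile_fun (hW : IsEternalVisc ε₀ νh α W) :
    ∃ r : ℤ → Em m, ∀ n : ℤ, Tendsto (fun σ : ℝ => Real.exp σ • W n σ) atTop (𝓝 (r n)) := by
  choose r hr using fun n : ℤ => WakeRatchetTerminal.exists_terminalProfile hW n
  exact ⟨r, hr⟩

/-- The renormalised shell energy converges to the squared norm of the terminal profile:
`e^{2σ}‖W_n(σ)‖² → ‖r_n‖²` (physically: `Λ^{2n} E_n(t) → Λ^{2n} E_n(t⋆)`).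
[cite: Tao2016AveragedNS, §4 Lemma 4.1 (4.10), §6.4; elementary] -/
theorem tendsto_renEnergy_of_terminal {n : ℤ} {r : Em m}
    (hr : Tendsto (fun σ : ℝ => Real.exp σ • W n σ) atTop (𝓝 r)) :
    Tendsto (fun σ : ℝ => Real.exp (2 * σ) * ‖W n σ‖ ^ 2) atTop (𝓝 (‖r‖ ^ 2)) := by
  have h : Tendsto (fun σ : ℝ => ‖Real.exp σ • W n σ‖ ^ 2) atTop (𝓝 (‖r‖ ^ 2)) := hr.norm.pow 2
  refine h.congr' (Eventually.of_forall fun σ => ?_)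
  have hexp : Real.exp σ ^ 2 = Real.exp (2 * σ) := by
    rw [← Real.exp_nat_mul]; norm_num
  rw [norm_smul, Real.norm_eq_abs, abs_of_pos (Real.exp_pos σ), mul_pow, hexp]

/-- **Dictionary.**  `physWeight(a)^n · x = (1+ε₀)^{a n} · (Λ^{-2n} x)`: with `x = ‖r_n‖² = Λ^{2n}E_n(t⋆)`
the weighted terminal quantity of this file is `(1+ε₀)^{an} E_n(t⋆)`, the `a`-weighted physical WAKE
energy (at `a = 1`: `(1+ε₀)^n E_n(t⋆)`, cf. `wtEnergy_eq`).
[cite: Tao2016AveragedNS, §4 (4.1), §6.4; cell vocabulary (`physWeight`, `bigLam`)] -/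
theorem physWeight_pow_mul_eq (hε : 0 ≤ ε₀) (n : ℕ) (x : ℝ) :
    physWeight a ε₀ ^ n * x = ((1 + ε₀) ^ a) ^ n * ((bigLam ε₀ ^ n)⁻¹ ^ 2 * x) := by
  have h5 : (1 + ε₀) ^ (5 : ℕ) = bigLam ε₀ ^ 2 := (bigLam_sq hε).symm
  have hw : physWeight a ε₀ = (1 + ε₀) ^ a * (bigLam ε₀ ^ 2)⁻¹ := by
    unfold physWeight
    rw [div_eq_mul_inv, h5]
  have key : ((bigLam ε₀ ^ 2)⁻¹) ^ n = (bigLam ε₀ ^ n)⁻¹ ^ 2 := by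
    rw [inv_pow, inv_pow, ← pow_mul, ← pow_mul, mul_comm]
  rw [hw, mul_pow, key, mul_assoc]

/-! ## A wake floor is survival -/

/-- **WAKE FLOOR ⇒ FORWARD (S_a)-SURVIVAL.**  If the terminal profile satisfies
`physWeight(a)^n ‖r_n‖² > c` for infinitely many shells `n ≥ 0` (some `c > 0`), then `W` is forward
(S_a)-surviving: the level `c` is reached on shell `n` at EVERY late log-time, since
`physWeight(a)^n e^{2σ}‖W_n(σ)‖² → physWeight(a)^n ‖r_n‖² > c`.  No table hypothesis, no bound, any `ν̂`.
[cite: Tao2016AveragedNS, §4 Lemma 4.1 (4.8)–(4.10), §6.4; cell vocabulary (`EternalSurvivingFwd`)] -/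
theorem survivingFwd_of_wakeFloor {r : ℤ → Em m}
    (hr : ∀ n : ℤ, Tendsto (fun σ : ℝ => Real.exp σ • W n σ) atTop (𝓝 (r n)))
    {c : ℝ} (hc : 0 < c)
    (hfloor : ∀ N : ℕ, ∃ n : ℕ, N ≤ n ∧ c < physWeight a ε₀ ^ n * ‖r n‖ ^ 2) :
    EternalSurvivingFwd a ε₀ W := by
  refine ⟨c, hc, fun N => ?_⟩
  obtain ⟨n, hNn, hlt⟩ := hfloor N
  have ht : Tendsto (fun σ : ℝ => physWeight a ε₀ ^ n * (Real.exp (2 * σ) * ‖W n σ‖ ^ 2)) atTop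
      (𝓝 (physWeight a ε₀ ^ n * ‖r n‖ ^ 2)) :=
    (tendsto_renEnergy_of_terminal (hr n)).const_mul _
  have hev : ∀ᶠ σ : ℝ in atTop, c ≤ physWeight a ε₀ ^ n * (Real.exp (2 * σ) * ‖W n σ‖ ^ 2) :=
    (ht.eventually (lt_mem_nhds hlt)).mono fun σ h => h.le
  obtain ⟨σ, hσc, hσN⟩ := (hev.and (eventually_ge_atTop (N : ℝ))).exists
  exact ⟨n, hNn, σ, hσN, hσc⟩

/-- **Contrapositive: a non-survivor's weighted wake tends to zero.**  If an admissible eternal solution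
is NOT forward (S_a)-surviving (`ε₀ ≥ 0`), then `physWeight(a)^n ‖r_n‖² → 0` as `n → ∞` in `ℕ` — the
wake spectrum is strictly steeper than the survival weight.
[cite: Tao2016AveragedNS, §4 Lemma 4.1 (4.8)–(4.10), §6.4; this file] -/
theorem weightedWake_tendsto_zero_of_not_survivingFwd (hε : 0 ≤ ε₀) {r : ℤ → Em m}
    (hr : ∀ n : ℤ, Tendsto (fun σ : ℝ => Real.exp σ • W n σ) atTop (𝓝 (r n)))
    (hns : ¬ EternalSurvivingFwd a ε₀ W) :
    Tendsto (fun n : ℕ => physWeight a ε₀ ^ n * ‖r n‖ ^ 2) atTop (𝓝 0) := by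
  rw [Metric.tendsto_atTop]
  intro c hc
  by_contra h
  push Not at h
  apply hns
  refine survivingFwd_of_wakeFloor hr (half_pos hc) fun N => ?_
  obtain ⟨n, hn, hle⟩ := h N
  refine ⟨n, hn, ?_⟩
  have h0 : 0 ≤ physWeight a ε₀ ^ n * ‖r n‖ ^ 2 :=
    mul_nonneg (pow_nonneg (physWeight_nonneg hε) _) (sq_nonneg _)
  rw [Real.dist_eq, sub_zero, abs_of_nonneg h0] at hle
  linarith

/-- The same, with the terminal profile produced internally (any admissible eternal solution, any
`ν̂ ≥ 0`, any table): non-survival at exponent `a` forces SOME terminal profile — hence THE terminal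
profile, limits being unique — to have weighted wake tending to zero.
[cite: Tao2016AveragedNS, §4 Lemma 4.1 (4.8)–(4.10), §6.4; this file] -/
theorem exists_terminal_weightedWake_tendsto_zero (hε : 0 ≤ ε₀) (hW : IsEternalVisc ε₀ νh α W)
    (hns : ¬ EternalSurvivingFwd a ε₀ W) :
    ∃ r : ℤ → Em m, (∀ n : ℤ, Tendsto (fun σ : ℝ => Real.exp σ • W n σ) atTop (𝓝 (r n))) ∧
      Tendsto (fun n : ℕ => physWeight a ε₀ ^ n * ‖r n‖ ^ 2) atTop (𝓝 0) := by
  obtain ⟨r, hr⟩ := exists_terminalProfile_fun hW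
  exact ⟨r, hr, weightedWake_tendsto_zero_of_not_survivingFwd hε hr hns⟩

/-! ## By name: what the crux and its inviscid child force on wakes, and the kill test -/

/-- **K1ᵛ(1) ⇒ a=1-WEIGHTED WAKE DECAY (by name).**  If `NoSurvivingEternalViscBddOne` holds then for every
spread `R ≥ 1`, below its threshold, every uniformly bounded admissible eternal solution (any `ν̂ ≥ 0`)
of every E₂(R) table has terminal profile with `physWeight(1)^n ‖r_n‖² = (1+ε₀)^n E_n(t⋆) → 0`.
[cite: Tao2016AveragedNS, §4 Thm. 4.2 (statement shape), Lemma 4.1 (4.8)–(4.10), §6.4; this file] -/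
theorem weightedWake_tendsto_zero_of_noSurvivingEternalViscBddOne (h : NoSurvivingEternalViscBddOne)
    {R : ℝ} (hR : 1 ≤ R) :
    ∃ εs : ℝ, 0 < εs ∧ ∀ ε₀ : ℝ, 0 < ε₀ → ε₀ ≤ εs →
      ∀ α : Fin 4 → Fin 4 → Fin 4 → ℤ × ℤ × ℤ → ℝ, InTableClass R α →
        ∀ (νh : ℝ) (W : ℤ → ℝ → Em 4), IsEternalVisc ε₀ νh α W → UniformBound W →
          ∀ r : ℤ → Em 4, (∀ n : ℤ, Tendsto (fun σ : ℝ => Real.exp σ • W n σ) atTop (𝓝 (r n))) →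
            Tendsto (fun n : ℕ => physWeight 1 ε₀ ^ n * ‖r n‖ ^ 2) atTop (𝓝 0) := by
  obtain ⟨εs, hεs, H⟩ := h R hR
  exact ⟨εs, hεs, fun ε₀ hε₀ hle α hα νh W hW hU r hr =>
    weightedWake_tendsto_zero_of_not_survivingFwd hε₀.le hr (H ε₀ hε₀ hle α hα νh W hW hU)⟩

/-- **(ρ0) ⇒ a=1-WEIGHTED WAKE DECAY, inviscid (by name).**  If the split child `NoSurvivingEternalBddOne`
holds then, below its threshold, every uniformly bounded admissible INVISCID eternal solution of every
E₂(R) table has `(1+ε₀)^n E_n(t⋆) → 0`.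
[cite: Tao2016AveragedNS, §4 Thm. 4.2 (statement shape), Lemma 4.1 (4.8)–(4.10), §6.4; this file] -/
theorem weightedWake_tendsto_zero_of_noSurvivingEternalBddOne (h : NoSurvivingEternalBddOne)
    {R : ℝ} (hR : 1 ≤ R) :
    ∃ εs : ℝ, 0 < εs ∧ ∀ ε₀ : ℝ, 0 < ε₀ → ε₀ ≤ εs →
      ∀ α : Fin 4 → Fin 4 → Fin 4 → ℤ × ℤ × ℤ → ℝ, InTableClass R α →
        ∀ W : ℤ → ℝ → Em 4, IsEternal ε₀ α W → UniformBound W →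
          ∀ r : ℤ → Em 4, (∀ n : ℤ, Tendsto (fun σ : ℝ => Real.exp σ • W n σ) atTop (𝓝 (r n))) →
            Tendsto (fun n : ℕ => physWeight 1 ε₀ ^ n * ‖r n‖ ^ 2) atTop (𝓝 0) := by
  obtain ⟨εs, hεs, H⟩ := h R hR
  exact ⟨εs, hεs, fun ε₀ hε₀ hle α hα W hW hU r hr =>
    weightedWake_tendsto_zero_of_not_survivingFwd hε₀.le hr (H ε₀ hε₀ hle α hα W hW hU)⟩

/-- **KILL TEST for K1ᵛ(1) on the wake.**  If at ONE spread `R ≥ 1`, for every threshold, some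
`ε₀` below it carries an E₂(R) table with a uniformly bounded admissible eternal solution (any `ν̂ ≥ 0`)
whose terminal profile keeps `physWeight(1)^n ‖r_n‖² = (1+ε₀)^n E_n(t⋆) > c > 0` on infinitely many
shells, then `NoSurvivingEternalViscBddOne` is FALSE.  (Numerically the fixed-table wake exponent tends to
`5/3 > 1`, so no such witness is known; the test is recorded, not met.)
[cite: Tao2016AveragedNS, §4 Thm. 4.2 (statement shape), §6.4; this file] -/
theorem not_noSurvivingEternalViscBddOne_of_wakeWitnesses {R : ℝ} (hR : 1 ≤ R)
    (h : ∀ εs : ℝ, 0 < εs → ∃ ε₀ : ℝ, 0 < ε₀ ∧ ε₀ ≤ εs ∧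
      ∃ (α : Fin 4 → Fin 4 → Fin 4 → ℤ × ℤ × ℤ → ℝ) (νh : ℝ) (W : ℤ → ℝ → Em 4) (r : ℤ → Em 4)
        (c : ℝ), InTableClass R α ∧ IsEternalVisc ε₀ νh α W ∧ UniformBound W ∧
          (∀ n : ℤ, Tendsto (fun σ : ℝ => Real.exp σ • W n σ) atTop (𝓝 (r n))) ∧
          0 < c ∧ ∀ N : ℕ, ∃ n : ℕ, N ≤ n ∧ c < physWeight 1 ε₀ ^ n * ‖r n‖ ^ 2) :
    ¬ NoSurvivingEternalViscBddOne := by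
  intro hK
  obtain ⟨εs, hεs, H⟩ := hK R hR
  obtain ⟨ε₀, hε₀, hle, α, νh, W, r, c, hα, hW, hU, hr, hc, hfl⟩ := h εs hεs
  exact H ε₀ hε₀ hle α hα νh W hW hU (survivingFwd_of_wakeFloor hr hc hfl)

/-- **KILL TEST for (ρ0) on the wake** (inviscid witnesses).
[cite: Tao2016AveragedNS, §4 Thm. 4.2 (statement shape), §6.4; this file] -/
theorem not_noSurvivingEternalBddOne_of_wakeWitnesses {R : ℝ} (hR : 1 ≤ R)
    (h : ∀ εs : ℝ, 0 < εs → ∃ ε₀ : ℝ, 0 < ε₀ ∧ ε₀ ≤ εs ∧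
      ∃ (α : Fin 4 → Fin 4 → Fin 4 → ℤ × ℤ × ℤ → ℝ) (W : ℤ → ℝ → Em 4) (r : ℤ → Em 4)
        (c : ℝ), InTableClass R α ∧ IsEternal ε₀ α W ∧ UniformBound W ∧
          (∀ n : ℤ, Tendsto (fun σ : ℝ => Real.exp σ • W n σ) atTop (𝓝 (r n))) ∧
          0 < c ∧ ∀ N : ℕ, ∃ n : ℕ, N ≤ n ∧ c < physWeight 1 ε₀ ^ n * ‖r n‖ ^ 2) :
    ¬ NoSurvivingEternalBddOne := by
  intro hK
  obtain ⟨εs, hεs, H⟩ := hK R hR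
  obtain ⟨ε₀, hε₀, hle, α, W, r, c, hα, hW, hU, hr, hc, hfl⟩ := h εs hεs
  exact H ε₀ hε₀ hle α hα W hW hU (survivingFwd_of_wakeFloor hr hc hfl)

end Summit.NavierStokesRegularity.NavierStokesRegularity.Theorems.NoSurvivingEternalViscBddOne.WakeCriterion

end
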